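import Summits.CriticalPhenomena.PercolationContinuityZ3.Theorems.PercNearOneGluingNoHeavyLowerTailSunflowerTBernEndgame
import HarnessLib

/-!
# `NoHeavyLowerTail` (crux stmt-CriticalPhenomena-4575), abstract sunflower cubic: T-BERN WITHOUT `vv`-LEVERAGE
# (every petal with `b·g_j ≤ a₀·u_j`, e.g. every hub + dwarf-pack family)

Support file (seat `prim-ineq-prove-1` gen 63; `--supports stmt-CriticalPhenomena-4575`).  No `sorry`, no named facts.
Memo: run/shared/lean/prim/prim-ineq-prove-1/FINDING-CONVEX-prove1-g63.md §3(β), §4.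

THE ABSTRACT THEOREM (`coefDom_prodPoly_of_gamma_le_x`).  Let `0 ≤ κ ≤ 1` and, for `j ∈ t`, `x_j ≥ 1`, `α_j := 1 + κ(x_j − 1)`,
`1 ≤ γ_j ≤ x_j`.  Then
  `∏_{j∈t} (α_j X + γ_j) ≤_coef (X+1)^(|t|−1) · (α(∏ x_j)·X + ∏ γ_j)`,   `α(X) := 1 + κ(X−1)`.
Proof = the sequential scheme of `…SunflowerTBernScheme` with the virtual state `(α(X_run), ∏γ_run)`: the `u`-heavy petals
(`γ_j ≤ α_j`) first — aligned steps, the state stays `u`-heavy (`zone_uprefix`) — then the γ-heavy ones, whose whole misalignment is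
"x-type" and fits into the one-coin defect: `α(X)γ + Gα ≤ Gγ + α(Xx)` whenever `G ≥ 1`, `α ≤ γ ≤ x` (`xstep_le`; `zone_extend`).
IN THE MODEL (`domOn_of_noLeverage`, `domOn_of_vv_le`): with `x_j = u_j/b`, `γ_j = g_j/a₀`, `κ = (1−s)b/A₀` the condition `γ_j ≤ x_j` reads
`b·g_j ≤ a₀·u_j`, implied by `b·vv_j ≤ β·u_j` ("no `vv`-leverage": the petal's `vv/β` does not exceed its `u/b`); the budgets turn
`α(∏x) ≤ 1/A₀`, `∏γ ≤ V/a₀` and the scaling `tcoeff_scale` turns the normalised certificate into `DomOn`.  So the `TBern` certificate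
holds for every admissible family without `vv`-leverage — all `u`-heavy petals, all dwarfs `(β,β,β)`, sub- and super-dwarfs, any hub with
`vv·b ≤ β·u`: this strictly contains the one-sided families of `…SunflowerDiagonalClasses` on the `u`-side and every "hub + dwarf pack"
family of the memo; what it leaves out are the `vv`-rich petals (h-petals `(b, vv, b)` and rich tight petals with `b·vv > β·u`), i.e.
exactly the families where the memo's endgame ★ is needed.
-/

noncomputable section

namespace Summit.CriticalPhenomena.PercolationContinuityZ3.Theorems.SunflowerPartition

namespace SafeCalc

namespace LinkedCurrency

open Finset Polynomial

variable {ι : Type*} [DecidableEq ι]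

/-! ## Scalar steps -/

/-- One-coin sub-multiplicativity of `α(x) = 1 + κ(x−1)`: `α(X)α(x) ≤ α(Xx)` for `κ ∈ [0,1]`, `X, x ≥ 1`. [this work] -/
theorem alpha_mul_le {κ X x : ℝ} (hκ0 : 0 ≤ κ) (hκ1 : κ ≤ 1) (hX : 1 ≤ X) (hx : 1 ≤ x) :
    (1 + κ * (X - 1)) * (1 + κ * (x - 1)) ≤ 1 + κ * (X * x - 1) := by
  have h : 0 ≤ κ * (1 - κ) * ((X - 1) * (x - 1)) :=
    mul_nonneg (mul_nonneg hκ0 (sub_nonneg.2 hκ1)) (mul_nonneg (sub_nonneg.2 hX) (sub_nonneg.2 hx))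
  nlinarith

/-- **The x-step**: the misalignment of a γ-heavy petal with `γ ≤ x` against the state `(α(X), G)`, `G ≥ 1`, fits into the one-coin
defect: `α(X)γ + Gα(x) ≤ Gγ + α(Xx)` (indeed the difference is `(G−1)(γ−α(x)) + κ(X−1)(x−γ)`). [this work] -/
theorem xstep_le {κ X x γ G : ℝ} (hκ0 : 0 ≤ κ) (hX : 1 ≤ X) (hG : 1 ≤ G) (hαγ : 1 + κ * (x - 1) ≤ γ) (hγx : γ ≤ x) :
    (1 + κ * (X - 1)) * γ + G * (1 + κ * (x - 1)) ≤ 1 * (G * γ) + 1 * (1 + κ * (X * x - 1)) := by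
  have h1 : 0 ≤ (G - 1) * (γ - (1 + κ * (x - 1))) := mul_nonneg (sub_nonneg.2 hG) (sub_nonneg.2 hαγ)
  have h2 : 0 ≤ κ * (X - 1) * (x - γ) := mul_nonneg (mul_nonneg hκ0 (sub_nonneg.2 hX)) (sub_nonneg.2 hγx)
  nlinarith

/-- **The u-step**: an aligned (`u`-heavy) petal against a `u`-heavy state: `Aγ + Gα ≤ Aα + Gγ`. [this work] -/
theorem ustep_le {A G α γ : ℝ} (hGA : G ≤ A) (hγα : γ ≤ α) : A * γ + G * α ≤ A * α + G * γ := by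
  nlinarith [mul_nonneg (sub_nonneg.2 hGA) (sub_nonneg.2 hγα)]

/-! ## The scheme with state `(α(∏x), ∏γ)` -/

/-- The `u`-heavy prefix: for a nonempty family of `u`-heavy petals (`1 ≤ γ_j ≤ α_j`), the certificate with state `(α(∏x), ∏γ)` holds
and the state is `u`-heavy. [this work] -/
theorem zone_uprefix {κ : ℝ} (hκ0 : 0 ≤ κ) (hκ1 : κ ≤ 1) (x γ : ι → ℝ) (t : Finset ι) (ht : t.Nonempty)
    (hx : ∀ j ∈ t, 1 ≤ x j) (hγ : ∀ j ∈ t, 1 ≤ γ j) (hu : ∀ j ∈ t, γ j ≤ 1 + κ * (x j - 1)) :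
    CoefDom (prodPoly t (fun j => 1 + κ * (x j - 1)) γ)
        ((C 1 * X + C 1) ^ (t.card - 1) * (C (1 + κ * (∏ j ∈ t, x j - 1)) * X + C (∏ j ∈ t, γ j))) ∧
      ∏ j ∈ t, γ j ≤ 1 + κ * (∏ j ∈ t, x j - 1) ∧ 1 ≤ ∏ j ∈ t, x j ∧ 1 ≤ ∏ j ∈ t, γ j := by
  classical
  induction t using Finset.induction_on with
  | empty => exact absurd ht Finset.not_nonempty_empty
  | @insert j s hj ih =>
    have hxj : 1 ≤ x j := hx j (mem_insert_self j s)
    have hγj : 1 ≤ γ j := hγ j (mem_insert_self j s)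
    have huj : γ j ≤ 1 + κ * (x j - 1) := hu j (mem_insert_self j s)
    rcases s.eq_empty_or_nonempty with hse | hsne
    · subst hse
      refine ⟨?_, ?_, ?_, ?_⟩
      · rw [LawfulSingleton.insert_empty_eq, prod_singleton, prod_singleton]
        exact coefDom_prodPoly_singleton le_rfl le_rfl
      · simpa using huj
      · simpa using hxj
      · simpa using hγj
    obtain ⟨hdom, hGA, hX1, hG1⟩ := ih hsne (fun i hi => hx i (mem_insert_of_mem hi)) (fun i hi => hγ i (mem_insert_of_mem hi))
      (fun i hi => hu i (mem_insert_of_mem hi))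
    rw [prod_insert hj, prod_insert hj]
    set Xs := ∏ i ∈ s, x i with hXs
    set Gs := ∏ i ∈ s, γ i with hGs
    have hαj0 : 0 ≤ 1 + κ * (x j - 1) := by nlinarith
    have hone := alpha_mul_le hκ0 hκ1 hX1 hxj
    refine ⟨?_, ?_, ?_, ?_⟩
    · refine coefDom_prodPoly_insert hj hsne zero_le_one zero_le_one hαj0 (zero_le_one.trans hγj) hdom ?_ ?_ ?_
      · rw [one_mul, mul_comm (x j) Xs]; exact hone
      · rw [one_mul, mul_comm (γ j) Gs]
      · have h1 := ustep_le hGA huj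
        rw [one_mul, one_mul, mul_comm (γ j) Gs, mul_comm (x j) Xs]
        linarith
    · -- the state stays u-heavy: Gs γ_j ≤ α(Xs) α(x_j) ≤ α(Xs x_j)
      have h1 : Gs * γ j ≤ (1 + κ * (Xs - 1)) * (1 + κ * (x j - 1)) :=
        mul_le_mul hGA huj (zero_le_one.trans hγj) (by nlinarith)
      rw [mul_comm (γ j) Gs, mul_comm (x j) Xs]
      exact h1.trans hone
    · rw [mul_comm]; nlinarith
    · rw [mul_comm]; nlinarith

/-- Extending a certificate with state `(α(X₀), G₀)` (`X₀, G₀ ≥ 1`) by γ-heavy petals with `γ ≤ x`. [this work] -/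
theorem zone_extend {κ : ℝ} (hκ0 : 0 ≤ κ) (hκ1 : κ ≤ 1) (x γ : ι → ℝ) (t₀ : Finset ι) (ht₀ : t₀.Nonempty) {X₀ G₀ : ℝ}
    (hX₀ : 1 ≤ X₀) (hG₀ : 1 ≤ G₀)
    (hdom : CoefDom (prodPoly t₀ (fun j => 1 + κ * (x j - 1)) γ)
      ((C 1 * X + C 1) ^ (t₀.card - 1) * (C (1 + κ * (X₀ - 1)) * X + C G₀)))
    (W : Finset ι) (hW : Disjoint t₀ W) (hx : ∀ j ∈ W, 1 ≤ x j) (hγx : ∀ j ∈ W, γ j ≤ x j)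
    (hg : ∀ j ∈ W, 1 + κ * (x j - 1) ≤ γ j) :
    CoefDom (prodPoly (t₀ ∪ W) (fun j => 1 + κ * (x j - 1)) γ)
      ((C 1 * X + C 1) ^ ((t₀ ∪ W).card - 1) * (C (1 + κ * (X₀ * ∏ j ∈ W, x j - 1)) * X + C (G₀ * ∏ j ∈ W, γ j))) := by
  classical
  induction W using Finset.induction_on with
  | empty => simpa using hdom
  | @insert j W hjW ih =>
    have hdis : Disjoint t₀ W := Disjoint.mono_right (subset_insert j W) hW
    have hjt : j ∉ t₀ := fun h => (disjoint_left.1 hW) h (mem_insert_self j W)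
    have hj : j ∉ t₀ ∪ W := by rw [mem_union, not_or]; exact ⟨hjt, hjW⟩
    have hxj : 1 ≤ x j := hx j (mem_insert_self j W)
    have hγxj : γ j ≤ x j := hγx j (mem_insert_self j W)
    have hgj : 1 + κ * (x j - 1) ≤ γ j := hg j (mem_insert_self j W)
    have key := ih hdis (fun i hi => hx i (mem_insert_of_mem hi)) (fun i hi => hγx i (mem_insert_of_mem hi))
      (fun i hi => hg i (mem_insert_of_mem hi))
    set XW := ∏ i ∈ W, x i with hXW
    set GW := ∏ i ∈ W, γ i with hGW
    have hXW1 : 1 ≤ XW := Pendant.one_le_prod_of_one_le W fun i hi => hx i (mem_insert_of_mem hi)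
    have hGW1 : 1 ≤ GW := Pendant.one_le_prod_of_one_le W fun i hi =>
      (show (1 : ℝ) ≤ 1 + κ * (x i - 1) by nlinarith [hx i (mem_insert_of_mem hi)]).trans (hg i (mem_insert_of_mem hi))
    have hXX : 1 ≤ X₀ * XW := by nlinarith
    have hGG : 1 ≤ G₀ * GW := by nlinarith
    have hne : (t₀ ∪ W).Nonempty := ht₀.mono subset_union_left
    have hαj0 : 0 ≤ 1 + κ * (x j - 1) := by nlinarith
    have hγj0 : 0 ≤ γ j := hαj0.trans hgj
    rw [union_insert, prod_insert hjW, prod_insert hjW]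
    refine coefDom_prodPoly_insert hj hne zero_le_one zero_le_one hαj0 hγj0 key ?_ ?_ ?_
    · rw [one_mul, show X₀ * (x j * XW) = (X₀ * XW) * x j by ring]; exact alpha_mul_le hκ0 hκ1 hXX hxj
    · rw [one_mul]; exact le_of_eq (by ring)
    · have h1 := xstep_le hκ0 hXX hGG hgj hγxj
      rw [show X₀ * (x j * XW) = (X₀ * XW) * x j by ring, show G₀ * (γ j * GW) = (G₀ * GW) * γ j by ring]
      linarith

/-- **T-BERN without `vv`-leverage, abstract form.**  `0 ≤ κ ≤ 1`, `x_j ≥ 1`, `1 ≤ γ_j ≤ x_j`, `α_j = 1 + κ(x_j − 1)`: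
`∏(α_jX + γ_j) ≤_coef (X+1)^(|t|−1)(α(∏x)X + ∏γ)`. [this work] -/
theorem coefDom_prodPoly_of_gamma_le_x {κ : ℝ} (hκ0 : 0 ≤ κ) (hκ1 : κ ≤ 1) (t : Finset ι) (ht : t.Nonempty)
    (x γ : ι → ℝ) (hx : ∀ j ∈ t, 1 ≤ x j) (hγ : ∀ j ∈ t, 1 ≤ γ j) (hγx : ∀ j ∈ t, γ j ≤ x j) :
    CoefDom (prodPoly t (fun j => 1 + κ * (x j - 1)) γ)
      ((C 1 * X + C 1) ^ (t.card - 1) * (C (1 + κ * (∏ j ∈ t, x j - 1)) * X + C (∏ j ∈ t, γ j))) := by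
  classical
  set U := t.filter (fun j => γ j ≤ 1 + κ * (x j - 1)) with hU
  set W := t.filter (fun j => ¬ γ j ≤ 1 + κ * (x j - 1)) with hWd
  have htUW : U ∪ W = t := filter_union_filter_not_eq _ t
  have hdisj : Disjoint U W := disjoint_filter_filter_not t t _
  have hWx : ∀ j ∈ W, 1 ≤ x j := fun j hj => hx j (mem_of_mem_filter j hj)
  have hWγx : ∀ j ∈ W, γ j ≤ x j := fun j hj => hγx j (mem_of_mem_filter j hj)
  have hWg : ∀ j ∈ W, 1 + κ * (x j - 1) ≤ γ j := fun j hj => (not_le.1 (mem_filter.1 hj).2).le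
  rcases U.eq_empty_or_nonempty with hUe | hUne
  · -- no u-heavy petal: start from a single γ-heavy one
    have hWt : W = t := by rw [← htUW, hUe, empty_union]
    obtain ⟨j₀, hj₀⟩ := ht
    have hj₀W : j₀ ∈ W := hWt ▸ hj₀
    set W' := W.erase j₀ with hW'
    have hdis0 : Disjoint ({j₀} : Finset ι) W' := by
      rw [disjoint_singleton_left]; exact notMem_erase j₀ W
    have htW : t = {j₀} ∪ W' := by rw [← hWt, hW', ← insert_eq, insert_erase hj₀W]
    have hbase : CoefDom (prodPoly {j₀} (fun j => 1 + κ * (x j - 1)) γ)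
        ((C 1 * X + C 1) ^ (({j₀} : Finset ι).card - 1) * (C (1 + κ * (x j₀ - 1)) * X + C (γ j₀))) :=
      coefDom_prodPoly_singleton le_rfl le_rfl
    have key := zone_extend hκ0 hκ1 x γ {j₀} (singleton_nonempty j₀) (hx j₀ hj₀) (hγ j₀ hj₀) hbase W' hdis0
      (fun i hi => hWx i (mem_of_mem_erase hi)) (fun i hi => hWγx i (mem_of_mem_erase hi))
      (fun i hi => hWg i (mem_of_mem_erase hi))
    have hj₀W' : j₀ ∉ W' := notMem_erase j₀ W
    rw [htW, ← insert_eq, prod_insert hj₀W', prod_insert hj₀W']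
    rw [← insert_eq] at key
    exact key
  · obtain ⟨hdom, _, hX1, hG1⟩ := zone_uprefix hκ0 hκ1 x γ U hUne (fun j hj => hx j (mem_of_mem_filter j hj))
      (fun j hj => hγ j (mem_of_mem_filter j hj)) (fun j hj => (mem_filter.1 hj).2)
    have key := zone_extend hκ0 hκ1 x γ U hUne hX1 hG1 hdom W hdisj hWx hWγx hWg
    rw [← htUW, prod_union hdisj, prod_union hdisj]
    exact key

/-! ## In the model: admissible families without `vv`-leverage -/

/-- The normalised comparison family: `∏_j (C (fullFloorA/A₀) X + C (fullFloorG/a₀)) = (X+1)^(n−1)·((1/A₀)X + V/a₀)`. [this work] -/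
theorem prodPoly_fullFloor_normalised (s b β V : ℝ) (n : ℕ) (hn : 0 < n) (hA₀ : s + (1 - s) * b ≠ 0)
    (ha₀ : (1 - s) * b + s * β ≠ 0) :
    prodPoly univ (fun j : Fin n => fullFloorA s b j / (s + (1 - s) * b))
        (fun j => fullFloorG s b β V j / ((1 - s) * b + s * β)) =
      (C 1 * X + C 1) ^ (n - 1) * (C (1 / (s + (1 - s) * b)) * X + C (V / ((1 - s) * b + s * β))) := by
  obtain ⟨n', rfl⟩ : ∃ n', n = n' + 1 := ⟨n - 1, by omega⟩
  unfold prodPoly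
  rw [Fin.prod_univ_succ]
  have h0 : C (fullFloorA s b (0 : Fin (n' + 1)) / (s + (1 - s) * b)) * X +
      C (fullFloorG s b β V (0 : Fin (n' + 1)) / ((1 - s) * b + s * β)) =
      C (1 / (s + (1 - s) * b)) * X + C (V / ((1 - s) * b + s * β)) := by
    simp [fullFloorA, fullFloorG]
  have hsucc : ∀ i : Fin n', C (fullFloorA s b i.succ / (s + (1 - s) * b)) * X +
      C (fullFloorG s b β V i.succ / ((1 - s) * b + s * β)) = C 1 * X + C 1 := by
    intro i
    have hne : ((i.succ : Fin (n' + 1)) : ℕ) ≠ 0 := by simp [Fin.val_succ]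
    simp only [fullFloorA, fullFloorG, hne, if_false, div_self hA₀, div_self ha₀]
  rw [h0, prod_congr rfl fun i _ => hsucc i, prod_const, card_univ, Fintype.card_fin]
  simp only [Nat.add_sub_cancel]
  ring

/-- **Bridge (normalised → `DomOn`).**  If the normalised family `(A_j/A₀, g_j/a₀)` is dominated by `(X+1)^(|t|−1)((1/A₀)X + V/a₀)`,
then `DomOn`. [this work] -/
theorem domOn_of_normalised {s b β V : ℝ} (hA₀ : 0 < s + (1 - s) * b) (ha₀ : 0 < (1 - s) * b + s * β)
    {t : Finset ι} (ht : t.Nonempty) {u vv m : ι → ℝ}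
    (h : CoefDom (prodPoly t (fun j => (s + (1 - s) * u j) / (s + (1 - s) * b))
        (fun j => ((1 - s) * m j + s * vv j) / ((1 - s) * b + s * β)))
      ((C 1 * X + C 1) ^ (t.card - 1) * (C (1 / (s + (1 - s) * b)) * X + C (V / ((1 - s) * b + s * β))))) :
    DomOn s b β V t u vv m := by
  set A₀ := s + (1 - s) * b with hA₀d
  set a₀ := (1 - s) * b + s * β with ha₀d
  intro k
  rw [coeff_prodPoly]
  -- the target's coefficients through the comparison family on `Fin t.card`
  have hn : 0 < t.card := ht.card_pos
  have htarget : ((C A₀ * X + C a₀) ^ (t.card - 1) * (C 1 * X + C V)).coeff k =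
      A₀ ^ k * a₀ ^ (t.card - k) * ((C 1 * X + C 1) ^ (t.card - 1) * (C (1 / A₀) * X + C (V / a₀))).coeff k := by
    rw [← prodPoly_fullFloor s b β V t.card hn, ← prodPoly_fullFloor_normalised s b β V t.card hn hA₀.ne' ha₀.ne',
      coeff_prodPoly, coeff_prodPoly]
    have e1 : (fullFloorA s b : Fin t.card → ℝ) = fun j => A₀ * (fullFloorA s b j / A₀) := by
      funext j; rw [mul_div_cancel₀ _ hA₀.ne']
    have e2 : (fullFloorG s b β V : Fin t.card → ℝ) = fun j => a₀ * (fullFloorG s b β V j / a₀) := by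
      funext j; rw [mul_div_cancel₀ _ ha₀.ne']
    conv_lhs => rw [e1, e2]
    rw [tcoeff_scale, card_univ, Fintype.card_fin]
  -- the family's coefficients, scaled
  have hfam : tcoeff t (fun j => s + (1 - s) * u j) (fun j => (1 - s) * m j + s * vv j) k =
      A₀ ^ k * a₀ ^ (t.card - k) * tcoeff t (fun j => (s + (1 - s) * u j) / A₀)
        (fun j => ((1 - s) * m j + s * vv j) / a₀) k := by
    rw [← tcoeff_scale]
    congr 1 <;> funext j
    · rw [mul_div_cancel₀ _ hA₀.ne']
    · rw [mul_div_cancel₀ _ ha₀.ne']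
  rw [hfam, htarget]
  have hk := h k
  rw [coeff_prodPoly] at hk
  exact mul_le_mul_of_nonneg_left hk (mul_nonneg (pow_nonneg hA₀.le _) (pow_nonneg ha₀.le _))

/-- **T-BERN WITHOUT `vv`-LEVERAGE (model form).**  Every nonempty admissible family with `b·g_j ≤ a₀·u_j` for all `j` admits the
`TBern` certificate `DomOn`. [this work] -/
theorem domOn_of_noLeverage {s b β V : ℝ} (hb : 0 < b) (hbβ : b ≤ β) (hs0 : 0 ≤ s) (hs1 : s ≤ 1) {t : Finset ι}
    (ht : t.Nonempty) {u vv m : ι → ℝ} (hadm : AdmissibleOn s b β V t u vv m)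
    (hlev : ∀ j ∈ t, b * ((1 - s) * m j + s * vv j) ≤ ((1 - s) * b + s * β) * u j) : DomOn s b β V t u vv m := by
  obtain ⟨hub, hu1, hvβ, _, hmb, _, _, hpu, _, hpg⟩ := hadm
  have hs' : 0 ≤ 1 - s := sub_nonneg.2 hs1
  set A₀ := s + (1 - s) * b with hA₀d
  set a₀ := (1 - s) * b + s * β with ha₀d
  have hb1 : b ≤ 1 := by obtain ⟨j, hj⟩ := ht; exact (hub j hj).trans (hu1 j hj)
  have hA₀ : 0 < A₀ := by
    have : 0 ≤ s * (1 - b) := mul_nonneg hs0 (sub_nonneg.2 hb1)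
    have e : A₀ = b + s * (1 - b) := by rw [hA₀d]; ring
    rw [e]; linarith
  have ha₀ : 0 < a₀ := by
    have : 0 ≤ s * (β - b) := mul_nonneg hs0 (sub_nonneg.2 hbβ)
    have e : a₀ = b + s * (β - b) := by rw [ha₀d]; ring
    rw [e]; linarith
  -- normalised data
  set κ := (1 - s) * b / A₀ with hκ
  have hκ0 : 0 ≤ κ := div_nonneg (mul_nonneg hs' hb.le) hA₀.le
  have hκ1 : κ ≤ 1 := by rw [hκ, div_le_one hA₀, hA₀d]; linarith
  set x : ι → ℝ := fun j => u j / b with hxd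
  set γ : ι → ℝ := fun j => ((1 - s) * m j + s * vv j) / a₀ with hγd
  have hx : ∀ j ∈ t, 1 ≤ x j := fun j hj => by rw [hxd]; exact (one_le_div hb).2 (hub j hj)
  have hγ : ∀ j ∈ t, 1 ≤ γ j := fun j hj => by
    rw [hγd]
    refine (one_le_div ha₀).2 ?_
    have := mul_le_mul_of_nonneg_left (hmb j hj) hs'
    have := mul_le_mul_of_nonneg_left (hvβ j hj) hs0
    rw [ha₀d]; linarith
  have hγx : ∀ j ∈ t, γ j ≤ x j := fun j hj => by
    rw [hγd, hxd, div_le_div_iff₀ ha₀ hb]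
    have := hlev j hj
    rw [ha₀d]; linarith
  have hA₀ne : A₀ ≠ 0 := hA₀.ne'
  have hbne : b ≠ 0 := hb.ne'
  have hα : ∀ j, (s + (1 - s) * u j) / A₀ = 1 + κ * (x j - 1) := by
    intro j
    rw [div_eq_iff hA₀ne, hκ]
    have e : (1 + (1 - s) * b / A₀ * (x j - 1)) * A₀ = A₀ + (1 - s) * b * (x j - 1) := by
      field_simp
    rw [e, hxd]
    have e2 : (1 - s) * b * (u j / b - 1) = (1 - s) * (u j - b) := by
      field_simp
    rw [e2, hA₀d]
    ring
  -- the abstract certificate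
  have key := coefDom_prodPoly_of_gamma_le_x hκ0 hκ1 t ht x γ hx hγ hγx
  -- budgets: α(∏x) ≤ 1/A₀ and ∏γ ≤ V/a₀
  have hX : ∏ j ∈ t, x j ≤ 1 / b := by
    rw [hxd, prod_div_distrib, prod_const, div_le_div_iff₀ (pow_pos hb _) hb, one_mul]
    calc (∏ j ∈ t, u j) * b ≤ b ^ (t.card - 1) * b := mul_le_mul_of_nonneg_right hpu hb.le
      _ = b ^ t.card := by rw [← pow_succ]; congr 1; have := ht.card_pos; omega
  have hαX : 1 + κ * (∏ j ∈ t, x j - 1) ≤ 1 / A₀ := by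
    have h1 : 1 + κ * (∏ j ∈ t, x j - 1) ≤ 1 + κ * (1 / b - 1) := by nlinarith
    have h2 : 1 + κ * (1 / b - 1) = 1 / A₀ := by
      rw [hκ, eq_div_iff hA₀ne]
      have e : (1 + (1 - s) * b / A₀ * (1 / b - 1)) * A₀ = A₀ + (1 - s) * b * (1 / b - 1) := by
        field_simp
      have e2 : (1 - s) * b * (1 / b - 1) = (1 - s) * (1 - b) := by
        field_simp
      rw [e, e2, hA₀d]
      ring
    linarith
  have hG : ∏ j ∈ t, γ j ≤ V / a₀ := by
    rw [hγd, prod_div_distrib, prod_const, div_le_div_iff₀ (pow_pos ha₀ _) ha₀]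
    calc (∏ j ∈ t, ((1 - s) * m j + s * vv j)) * a₀ ≤ a₀ ^ (t.card - 1) * V * a₀ :=
          mul_le_mul_of_nonneg_right hpg ha₀.le
      _ = V * a₀ ^ t.card := by
          have hc : t.card = (t.card - 1) + 1 := by have := ht.card_pos; omega
          conv_rhs => rw [hc, pow_succ]
          ring
  have hfl : CoefNonneg ((C (1 : ℝ) * X + C 1) ^ (t.card - 1)) := (coefNonneg_lin zero_le_one zero_le_one).pow _
  have key2 : CoefDom (prodPoly t (fun j => 1 + κ * (x j - 1)) γ)
      ((C 1 * X + C 1) ^ (t.card - 1) * (C (1 / A₀) * X + C (V / a₀))) :=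
    key.trans ((coefDom_lin hαX hG).mul_left hfl)
  refine domOn_of_normalised hA₀ ha₀ ht ?_
  have e : (fun j => (s + (1 - s) * u j) / A₀) = fun j => 1 + κ * (x j - 1) := funext hα
  rw [e]
  exact key2

/-- **Corollary**: every nonempty admissible family in which every petal has `b·vv_j ≤ β·u_j` (in particular every family of a hub with
`vv = β` and dwarfs / sub-dwarfs) admits the `TBern` certificate. [this work] -/
theorem domOn_of_vv_le {s b β V : ℝ} (hb : 0 < b) (hbβ : b ≤ β) (hs0 : 0 ≤ s) (hs1 : s ≤ 1) {t : Finset ι}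
    (ht : t.Nonempty) {u vv m : ι → ℝ} (hadm : AdmissibleOn s b β V t u vv m)
    (hz : ∀ j ∈ t, b * vv j ≤ β * u j) : DomOn s b β V t u vv m := by
  refine domOn_of_noLeverage hb hbβ hs0 hs1 ht hadm fun j hj => ?_
  obtain ⟨_, _, _, _, _, hmu, _⟩ := hadm
  have hs' : 0 ≤ 1 - s := sub_nonneg.2 hs1
  have h1 : b * ((1 - s) * m j) ≤ b * ((1 - s) * u j) :=
    mul_le_mul_of_nonneg_left (mul_le_mul_of_nonneg_left (hmu j hj) hs') hb.le
  have h2 : s * (b * vv j) ≤ s * (β * u j) := mul_le_mul_of_nonneg_left (hz j hj) hs0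
  nlinarith

end LinkedCurrency

end SafeCalc

end Summit.CriticalPhenomena.PercolationContinuityZ3.Theorems.SunflowerPartition
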